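import Mathlib.Analysis.InnerProductSpace.Calculus
import Literature.Analysis.ODE.SchrodingerSturm
import HarnessLib

/-!
# Transition-zone growth bound for `y″ = q y` with small coefficient

Topic `Literature/Analysis/ODE` (namespace `Literature.Analysis.ODE`). The crude a priori bound for
COMPLEX solutions of the scalar linear equation `y″ = q(x) y` (`q` complex) on an interval
`[α, α + L]` on which only the size of the coefficient is controlled, `‖q‖ ≤ K²`:

* `norm_le_of_norm_coeff_le_sq` — for every base point `x₀ ∈ [α, α + L]` and every
  `x ∈ [α, α + L]` (forward AND backward),
  `‖y x‖ ≤ (‖y x₀‖ + L ‖y′ x₀‖) · e^{max(KL,1)}` and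
  `‖y′ x‖ ≤ (max(K, 1/L) ‖y x₀‖ + ‖y′ x₀‖) · e^{max(KL,1)}`.

The point is uniformity as `K → 0`: Grönwall applied to the first-order system
`(y, y′)′ = (y′, q y)` with the weight adapted to `q` (energy `K²|y|² + |y′|²`, rate `2K`) recovers
`y` from the energy only with a loss `1/K`, while the unweighted system (`|y|² + |y′|²`, rate
`1 + K²`) loses `e^{(1+K²)L}`. The remedy is the effective wavenumber `Kₑ := max(K, 1/L)`:
still `‖q‖ ≤ Kₑ²`, the energy `E = Kₑ²|y|² + |y′|²` satisfies `|E′| ≤ 2Kₑ E`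
(`abs_zoneEnergyDeriv_le`, by Cauchy–Schwarz and `2Kₑ|y||y′| ≤ E`), hence
`E(x) ≤ E(x₀) e^{2Kₑ|x − x₀|}` (`zoneEnergy_le_zoneEnergy_mul_exp`, through the two-sided
differential Grönwall lemma `le_mul_exp_abs_of_abs_deriv_le`, assembled from the one-sided
`le_mul_exp_of_deriv_le` / `le_mul_exp_of_le_deriv` of `SchrodingerSturm.lean`), and finally
`Kₑ |x − x₀| ≤ Kₑ L = max(KL, 1)` (`max_inv_mul_length`) and `1/Kₑ ≤ L`. This is exactly the
bound used to cross "transition zones" (neighbourhoods of turning points of `r*`-length `L`,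
where `|Φ| ≤ K²` and no Liouville–Green / WKB control is available) between the oscillatory and
the exponential regimes of a one-dimensional Schrödinger equation, at a cost `e^{max(KL,1)}`
independent of the large parameter.

Hypotheses are pointwise `HasDerivAt` statements on the closed interval for `y, y′ : ℝ → ℂ`
(real `q` is the special case of a real-valued coefficient coerced to `ℂ`); `ℂ` is used as a real
inner-product space only through `HasDerivAt.norm_sq` and `abs_real_inner_le_norm`, so no
convention on the real inner product `⟪·, ·⟫` of `ℂ` enters. Everything is proved; nothing about
turning-point asymptotics (Airy comparison) is here.

## References
* P. Hartman, *Ordinary Differential Equations*, Classics in Applied Mathematics 38 (SIAM 2002),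
  Ch. IV §1, Lemma 1.1 (a priori bounds `|y(t)| ≤ |y₀| e^{K|t − t₀|}` for linear systems) and
  §4 (the same via a Lyapunov/energy function). Key `Hartman2002`.
* F. W. J. Olver, *Asymptotics and Special Functions* (Academic Press 1974), Ch. 6 §2 (the
  Liouville–Green approximation and its error bounds, which degenerate at turning points and must
  be bridged by an elementary bound of the present kind). Key `Olver1974`.
-/

noncomputable section

open Set Filter Topology
open scoped RealInnerProductSpace

namespace Literature.Analysis.ODE

/-! ### Two-sided differential Grönwall lemma for a scalar function -/

/-- **Two-sided differential Grönwall.** If `f : ℝ → ℝ` has derivative `f′` at every point of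
`[a, b]` and `|f′| ≤ C f` there, then `f x ≤ f x₀ · e^{C |x − x₀|}` for all `x₀, x ∈ [a, b]`:
the bound propagates both forward (`f′ ≤ C f`, `le_mul_exp_of_deriv_le` on `[x₀, x]`) and
backward (`−C f ≤ f′`, `le_mul_exp_of_le_deriv` on `[x, x₀]`) from the base point. [folklore] -/
theorem le_mul_exp_abs_of_abs_deriv_le {f f' : ℝ → ℝ} {a b C : ℝ}
    (hf : ∀ x ∈ Icc a b, HasDerivAt f (f' x) x) (hb : ∀ x ∈ Icc a b, |f' x| ≤ C * f x)
    {x₀ x : ℝ} (hx₀ : x₀ ∈ Icc a b) (hx : x ∈ Icc a b) :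
    f x ≤ f x₀ * Real.exp (C * |x - x₀|) := by
  rcases le_total x₀ x with hle | hle
  · -- forward from `x₀`: `f′ ≤ C f = -(-C) f` on `[x₀, x]`
    have hsub : Icc x₀ x ⊆ Icc a b := Icc_subset_Icc hx₀.1 hx.2
    have h := le_mul_exp_of_deriv_le (κ := -C)
      (fun s hs => (hf s (hsub hs)).differentiableAt.hasDerivAt)
      (fun s hs => by
        rw [(hf s (hsub hs)).deriv, neg_neg]
        exact (le_abs_self _).trans (hb s (hsub hs)))
      x (right_mem_Icc.2 hle)
    rw [abs_of_nonneg (sub_nonneg.2 hle)]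
    rwa [neg_neg] at h
  · -- backward from `x₀`: `-C f ≤ f′` on `[x, x₀]`
    have hsub : Icc x x₀ ⊆ Icc a b := Icc_subset_Icc hx.1 hx₀.2
    have h := le_mul_exp_of_le_deriv (κ := -C)
      (fun s hs => (hf s (hsub hs)).differentiableAt.hasDerivAt)
      (fun s hs => by
        rw [(hf s (hsub hs)).deriv]
        have := (neg_le_abs _).trans (hb s (hsub hs))
        linarith)
      x (left_mem_Icc.2 hle)
    rw [abs_of_nonpos (sub_nonpos.2 hle), neg_sub]
    rwa [neg_neg] at h

/-! ### The zone energy `c |y|² + |y′|²` along `y″ = q y` -/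

/-- Derivative of the weighted energy along `y″ = q y` (complex `y`, `q`; `ℂ` as a real
inner-product space): `(c |y|² + |y′|²)′ = c · 2⟪y, y′⟫ + 2⟪y′, q y⟫`. [folklore] -/
theorem hasDerivAt_zoneEnergy {y y' : ℝ → ℂ} {q : ℝ → ℂ} (c : ℝ) {x : ℝ}
    (hy : HasDerivAt y (y' x) x) (hy' : HasDerivAt y' (q x * y x) x) :
    HasDerivAt (fun t => c * ‖y t‖ ^ 2 + ‖y' t‖ ^ 2)
      (c * (2 * ⟪y x, y' x⟫) + 2 * ⟪y' x, q x * y x⟫) x :=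
  (hy.norm_sq.const_mul c).add hy'.norm_sq

/-- **The energy inequality.** If `0 ≤ Kₑ` and `‖w‖ ≤ Kₑ²` then
`|Kₑ² · 2⟪u, v⟫ + 2⟪v, w u⟫| ≤ 2Kₑ (Kₑ² |u|² + |v|²)` (Cauchy–Schwarz and
`2Kₑ|u||v| ≤ Kₑ²|u|² + |v|²`): along `y″ = q y` with `‖q‖ ≤ Kₑ²` the energy `E = Kₑ²|y|² + |y′|²`
obeys `|E′| ≤ 2Kₑ E`. [folklore] -/
theorem abs_zoneEnergyDeriv_le {Kₑ : ℝ} (hKₑ : 0 ≤ Kₑ) {u v w : ℂ} (hw : ‖w‖ ≤ Kₑ ^ 2) :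
    |Kₑ ^ 2 * (2 * ⟪u, v⟫) + 2 * ⟪v, w * u⟫| ≤ 2 * Kₑ * (Kₑ ^ 2 * ‖u‖ ^ 2 + ‖v‖ ^ 2) := by
  have h1 : |⟪u, v⟫| ≤ ‖u‖ * ‖v‖ := abs_real_inner_le_norm u v
  have h2 : |⟪v, w * u⟫| ≤ ‖v‖ * (Kₑ ^ 2 * ‖u‖) :=
    calc |⟪v, w * u⟫| ≤ ‖v‖ * ‖w * u‖ := abs_real_inner_le_norm v (w * u)
      _ = ‖v‖ * (‖w‖ * ‖u‖) := by rw [norm_mul]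
      _ ≤ ‖v‖ * (Kₑ ^ 2 * ‖u‖) := by gcongr
  have h3 : 2 * Kₑ * ‖u‖ * ‖v‖ ≤ Kₑ ^ 2 * ‖u‖ ^ 2 + ‖v‖ ^ 2 := by
    nlinarith [sq_nonneg (Kₑ * ‖u‖ - ‖v‖)]
  calc |Kₑ ^ 2 * (2 * ⟪u, v⟫) + 2 * ⟪v, w * u⟫|
      ≤ |Kₑ ^ 2 * (2 * ⟪u, v⟫)| + |2 * ⟪v, w * u⟫| := abs_add_le _ _
    _ = Kₑ ^ 2 * (2 * |⟪u, v⟫|) + 2 * |⟪v, w * u⟫| := by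
      rw [abs_mul, abs_mul, abs_mul, abs_of_nonneg (sq_nonneg Kₑ), abs_two]
    _ ≤ Kₑ ^ 2 * (2 * (‖u‖ * ‖v‖)) + 2 * (‖v‖ * (Kₑ ^ 2 * ‖u‖)) := by gcongr
    _ = 2 * Kₑ * (2 * Kₑ * ‖u‖ * ‖v‖) := by ring
    _ ≤ 2 * Kₑ * (Kₑ ^ 2 * ‖u‖ ^ 2 + ‖v‖ ^ 2) := mul_le_mul_of_nonneg_left h3 (by positivity)

/-- **Two-sided energy growth along `y″ = q y`.** If `‖q‖ ≤ Kₑ²` (`Kₑ ≥ 0`) on `[a, b]` then the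
energy `E = Kₑ²|y|² + |y′|²` of a complex solution satisfies `E(x) ≤ E(x₀) e^{2Kₑ|x − x₀|}` for all
`x₀, x ∈ [a, b]` (Hartman's a priori bound for the first-order system in the `Kₑ`-weighted norm).
[cite: Hartman2002, Ch. IV §1, Lemma 1.1] -/
theorem zoneEnergy_le_zoneEnergy_mul_exp {y y' : ℝ → ℂ} {q : ℝ → ℂ} {a b Kₑ : ℝ} (hKₑ : 0 ≤ Kₑ)
    (hy : ∀ x ∈ Icc a b, HasDerivAt y (y' x) x ∧ HasDerivAt y' (q x * y x) x)
    (hq : ∀ x ∈ Icc a b, ‖q x‖ ≤ Kₑ ^ 2) {x₀ x : ℝ} (hx₀ : x₀ ∈ Icc a b) (hx : x ∈ Icc a b) :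
    Kₑ ^ 2 * ‖y x‖ ^ 2 + ‖y' x‖ ^ 2 ≤
      (Kₑ ^ 2 * ‖y x₀‖ ^ 2 + ‖y' x₀‖ ^ 2) * Real.exp (2 * Kₑ * |x - x₀|) :=
  le_mul_exp_abs_of_abs_deriv_le (f := fun t => Kₑ ^ 2 * ‖y t‖ ^ 2 + ‖y' t‖ ^ 2)
    (f' := fun t => Kₑ ^ 2 * (2 * ⟪y t, y' t⟫) + 2 * ⟪y' t, q t * y t⟫)
    (fun t ht => hasDerivAt_zoneEnergy (Kₑ ^ 2) (hy t ht).1 (hy t ht).2)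
    (fun t ht => abs_zoneEnergyDeriv_le hKₑ (hq t ht)) hx₀ hx

/-! ### The transition-zone bound -/

/-- `max K L⁻¹ · L = max (K L) 1` for `L > 0`: the effective wavenumber `Kₑ = max(K, 1/L)` times
the length of the zone. [folklore] -/
theorem max_inv_mul_length {K L : ℝ} (hL : 0 < L) : max K L⁻¹ * L = max (K * L) 1 := by
  rw [max_mul_of_nonneg _ _ hL.le, inv_mul_cancel₀ hL.ne']

/-- **Transition-zone growth bound** (Hartman, *ODE*, Ch. IV §1, Lemma 1.1, in the weighted energy
`max(K,1/L)²|y|² + |y′|²`). Let `y″ = q y` on `[α, α + L]` (`L > 0`) with complex `y`, `q` and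
`‖q‖ ≤ K²` (`K ≥ 0`). Then for all `x₀, x ∈ [α, α + L]`,
`‖y x‖ ≤ (‖y x₀‖ + L ‖y′ x₀‖) e^{max(KL,1)}` and
`‖y′ x‖ ≤ (max(K, 1/L) ‖y x₀‖ + ‖y′ x₀‖) e^{max(KL,1)}` — a growth factor uniform as `K → 0`,
valid forward and backward from the base point `x₀`. [cite: Hartman2002, Ch. IV §1, Lemma 1.1] -/
theorem norm_le_of_norm_coeff_le_sq {y y' : ℝ → ℂ} {q : ℝ → ℂ} {α L K : ℝ} (hL : 0 < L)
    (hK : 0 ≤ K)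
    (hy : ∀ x ∈ Icc α (α + L), HasDerivAt y (y' x) x ∧ HasDerivAt y' (q x * y x) x)
    (hq : ∀ x ∈ Icc α (α + L), ‖q x‖ ≤ K ^ 2) {x₀ x : ℝ} (hx₀ : x₀ ∈ Icc α (α + L))
    (hx : x ∈ Icc α (α + L)) :
    ‖y x‖ ≤ (‖y x₀‖ + L * ‖y' x₀‖) * Real.exp (max (K * L) 1) ∧
    ‖y' x‖ ≤ (max K L⁻¹ * ‖y x₀‖ + ‖y' x₀‖) * Real.exp (max (K * L) 1) := by
  rw [← max_inv_mul_length hL]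
  set Kₑ := max K L⁻¹ with hKₑ_def
  have hKₑK : K ≤ Kₑ := le_max_left _ _
  have hKₑL : L⁻¹ ≤ Kₑ := le_max_right _ _
  have hKₑpos : 0 < Kₑ := (inv_pos.2 hL).trans_le hKₑL
  have hKₑne : Kₑ ≠ 0 := hKₑpos.ne'
  have hinvK : Kₑ⁻¹ ≤ L := inv_le_of_inv_le₀ hL hKₑL
  -- the two-sided energy bound with `‖q‖ ≤ K² ≤ Kₑ²`
  have hq' : ∀ t ∈ Icc α (α + L), ‖q t‖ ≤ Kₑ ^ 2 := fun t ht =>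
    (hq t ht).trans (pow_le_pow_left₀ hK hKₑK 2)
  have hE := zoneEnergy_le_zoneEnergy_mul_exp hKₑpos.le hy hq' hx₀ hx
  -- `2 Kₑ |x - x₀| ≤ 2 Kₑ L`
  have habs : |x - x₀| ≤ L := by
    rw [abs_le]
    constructor <;> linarith [hx.1, hx.2, hx₀.1, hx₀.2]
  have hexp : Real.exp (2 * Kₑ * |x - x₀|) ≤ Real.exp (Kₑ * L) ^ 2 := by
    rw [sq, ← Real.exp_add, Real.exp_le_exp]
    have := mul_le_mul_of_nonneg_left habs hKₑpos.le
    linarith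
  -- `E(x₀) ≤ (Kₑ ‖y x₀‖ + ‖y′ x₀‖)²`
  have hE₀ : Kₑ ^ 2 * ‖y x₀‖ ^ 2 + ‖y' x₀‖ ^ 2 ≤ (Kₑ * ‖y x₀‖ + ‖y' x₀‖) ^ 2 := by
    nlinarith [mul_nonneg (mul_nonneg hKₑpos.le (norm_nonneg (y x₀))) (norm_nonneg (y' x₀))]
  have hB₀ : 0 ≤ (Kₑ * ‖y x₀‖ + ‖y' x₀‖) * Real.exp (Kₑ * L) := by positivity
  have hEB : Kₑ ^ 2 * ‖y x‖ ^ 2 + ‖y' x‖ ^ 2 ≤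
      ((Kₑ * ‖y x₀‖ + ‖y' x₀‖) * Real.exp (Kₑ * L)) ^ 2 :=
    calc Kₑ ^ 2 * ‖y x‖ ^ 2 + ‖y' x‖ ^ 2
        ≤ (Kₑ ^ 2 * ‖y x₀‖ ^ 2 + ‖y' x₀‖ ^ 2) * Real.exp (2 * Kₑ * |x - x₀|) := hE
      _ ≤ (Kₑ * ‖y x₀‖ + ‖y' x₀‖) ^ 2 * Real.exp (Kₑ * L) ^ 2 := by gcongr
      _ = ((Kₑ * ‖y x₀‖ + ‖y' x₀‖) * Real.exp (Kₑ * L)) ^ 2 := by rw [mul_pow]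
  -- the derivative
  have h₂ : ‖y' x‖ ≤ (Kₑ * ‖y x₀‖ + ‖y' x₀‖) * Real.exp (Kₑ * L) := by
    refine (sq_le_sq₀ (norm_nonneg _) hB₀).1 ((le_add_of_nonneg_left ?_).trans hEB)
    positivity
  -- the function: `Kₑ ‖y x‖ ≤ B`, then divide by `Kₑ` and use `1/Kₑ ≤ L`
  have h₁' : Kₑ * ‖y x‖ ≤ (Kₑ * ‖y x₀‖ + ‖y' x₀‖) * Real.exp (Kₑ * L) := by
    refine (sq_le_sq₀ (by positivity) hB₀).1 (le_trans ?_ hEB)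
    rw [mul_pow]
    exact le_add_of_nonneg_right (by positivity)
  have h₁ : ‖y x‖ ≤ (‖y x₀‖ + L * ‖y' x₀‖) * Real.exp (Kₑ * L) :=
    calc ‖y x‖ = Kₑ⁻¹ * (Kₑ * ‖y x‖) := by rw [← mul_assoc, inv_mul_cancel₀ hKₑne, one_mul]
      _ ≤ Kₑ⁻¹ * ((Kₑ * ‖y x₀‖ + ‖y' x₀‖) * Real.exp (Kₑ * L)) :=
        mul_le_mul_of_nonneg_left h₁' (inv_pos.2 hKₑpos).le
      _ = (‖y x₀‖ + Kₑ⁻¹ * ‖y' x₀‖) * Real.exp (Kₑ * L) := by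
        linear_combination (‖y x₀‖ * Real.exp (Kₑ * L)) * inv_mul_cancel₀ hKₑne
      _ ≤ (‖y x₀‖ + L * ‖y' x₀‖) * Real.exp (Kₑ * L) := by gcongr
  exact ⟨h₁, h₂⟩

end Literature.Analysis.ODE
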